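import Summits.SmoothPoincare4.SmoothPoincare4.Theorems.ConvexBisectionSteinBisectionExistsIsotopicForm
import HarnessLib

/-!
# `ConvexBisection.SteinBisectionExists` (item stmt-SmoothPoincare4-10509): Baykur's theorem from its
# open-book rendering

The support item `Summit.SmoothPoincare4.SmoothPoincare4.Theses.ConvexBisection.SteinBisectionExists`
(every smooth `M ≃ₕ S⁴` admits a Stein bisection along a common contact seam) is closed in the
tree CONDITIONALLY on the named fact `Literature.Geometry.Symplectic.baykur_kahlerDecomposition`
(R. İ. Baykur, *Kähler decomposition of 4-manifolds*, Algebr. Geom. Topol. 6 (2006), Thm. 5.1;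
`steinBisectionExists_of_baykur`, `Theorems/ConvexBisectionSteinBisectionExistsOfKahlerDecomposition.lean`).
This file supplies the PROVED contact-topological tail through which that XL fact reduces to
the three Lefschetz-model facts of the crux line
`Cruxes/AcyclicBisectionExists/Lines/modp-braid-orbits.lean` (the reduction itself is the sibling
file `ConvexBisectionSteinBisectionExistsOfLefschetzFacts.lean`):

* `baykur_kahlerDecomposition_of_openBook` — **open book ⇒ the fact**: the open-book rendering of
  Thm. 5.1 (every closed connected orientable smooth 4-manifold is a gluing `X = W₁ ∪_φ W₂` into
  two compact Stein domains with ONE open book of `∂W₁` carrying Giroux forms, of the same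
  orientation, for both induced seam contact structures — print's *"the open book decompositions
  … are compatible with `ξ₊` and `ξ₋`, respectively, and they coincide"*) implies the tree's
  pointwise rendering `baykur_kahlerDecomposition`, by Giroux's uniqueness and Gray's stability
  (`GirouxContactPath_holds`, `GrayStability_holds`, both PROVED; `exists_isotopicForm_of_commonOpenBook`)
  and collar re-gluing / the chain rule (`isotopicGluingMap_of_isotopicForm`,
  `baykur_kahlerDecomposition_iff_isotopicGluingMap`, file
  `ConvexBisectionSteinBisectionExistsIsotopicForm.lean`);
* `steinBisectionExists_of_kahlerDecomposition_openBook'` — the item from the open-book rendering,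
  i.e. `steinBisectionExists_of_kahlerDecomposition_openBook` with its Giroux hypothesis discharged.

No new definitions, no new named facts.

## References

* R. İ. Baykur, *Kähler decomposition of 4-manifolds*, Algebr. Geom. Topol. 6 (2006) 1239–1265,
  arXiv:math/0601396, Thm. 5.1, §5 pp. 12–14. [Baykur2006]
* J. B. Etnyre, *Lectures on open book decompositions and contact structures*, Clay Math. Proc. 5
  (2006), Prop. 3.18. [Etnyre2006]
* H. Geiges, *An Introduction to Contact Topology*, CUP (2008), Thm. 2.2.2. [Geiges2008]
-/

noncomputable section

-- the prescribed namespace `Summit.<P>.<Sub>.…` duplicates `SmoothPoincare4` (P = Sub)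
set_option linter.dupNamespace false

open scoped Manifold ContDiff Topology ContinuousMap
open Set Function
open Literature.Geometry.Symplectic Literature.Topology.FourManifolds

namespace Summit.SmoothPoincare4.SmoothPoincare4.Theorems.SteinBisection

open Summit.SmoothPoincare4.SmoothPoincare4.Theses.ConvexBisection

/-! ## Baykur's Thm. 5.1: the open-book rendering implies the pointwise one -/

/-- **The open-book rendering of Baykur's Thm. 5.1 implies the tree's named fact
`baykur_kahlerDecomposition`.**  If every closed connected orientable smooth 4-manifold is a gluing
`W₁ ∪_φ W₂` of two compact Stein domains with one open book of `∂W₁` carrying Giroux forms, of the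
same orientation, for `ξ₁'` and `φ^* ξ₂'`, then the two seam contact structures differ by a
diffeomorphism isotopic to the identity (Giroux's uniqueness + Gray's stability:
`GirouxContactPath_holds`, `GrayStability_holds`, PROVED, through
`exists_isotopicForm_of_commonOpenBook`), which re-glues to the pointwise clause
(`isotopicGluingMap_of_isotopicForm`, `baykur_kahlerDecomposition_iff_isotopicGluingMap`).
[cite: Baykur2006, Thm. 5.1] -/
theorem baykur_kahlerDecomposition_of_openBook
    (hK : ∀ (X : Type) [TopologicalSpace X] [T2Space X] [SecondCountableTopology X] [CompactSpace X]
        [ConnectedSpace X] [ChartedSpace (EuclideanSpace ℝ (Fin 4)) X] [IsManifold (𝓡 4) ∞ X],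
        IsOrientable (𝓡 4) X →
        ∃ (W₁ : Type) (_ : TopologicalSpace W₁) (_ : ChartedSpace (EuclideanHalfSpace 4) W₁)
          (_ : IsManifold (𝓡∂ 4) ∞ W₁) (_ : CompactSpace W₁)
          (W₂ : Type) (_ : TopologicalSpace W₂) (_ : ChartedSpace (EuclideanHalfSpace 4) W₂)
          (_ : IsManifold (𝓡∂ 4) ∞ W₂) (_ : CompactSpace W₂)
          (S₁ : SteinStructure W₁) (S₂ : SteinStructure W₂)
          (b₁ : BoundaryData (𝓡∂ 4) W₁ (𝓡 3)) (b₂ : BoundaryData (𝓡∂ 4) W₂ (𝓡 3))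
          (φ : b₁.carrier ≃ₘ⟮𝓡 3, 𝓡 3⟯ b₂.carrier)
          (ob : OpenBook b₁.carrier) (α α' : Literature.Geometry.Kaehler.MForm (𝓡 3) b₁.carrier ℝ 1),
          IsBoundaryGluing b₁ b₂ φ (𝓡 4) X ∧
          ob.IsGirouxForm (boundaryPlaneField S₁.J b₁) α ∧
          ob.IsGirouxForm (fun y => (boundaryPlaneField S₂.J b₂ (φ y)).comap
            (mfderiv (𝓡 3) (𝓡 3) φ y).toLinearMap) α' ∧
          ∀ y u v w, 0 < wedge₁₂ (α y) (Literature.Geometry.Kaehler.mextDeriv α y) u v w ↔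
            0 < wedge₁₂ (α' y) (Literature.Geometry.Kaehler.mextDeriv α' y) u v w) :
    baykur_kahlerDecomposition := by
  rw [baykur_kahlerDecomposition_iff_isotopicGluingMap]
  intro X _ _ _ _ _ _ _ hO
  obtain ⟨W₁, t₁, c₁, m₁, k₁, W₂, t₂, c₂, m₂, k₂, S₁, S₂, b₁, b₂, φ, ob, α, α', hglue, hα, hα', hor⟩ :=
    hK X hO
  -- `W₁` is Hausdorff: it embeds into the Hausdorff `X` through the gluing
  haveI : T2Space W₁ := by
    obtain ⟨jA, _, hA, -, -, -⟩ := hglue.isClosedGluing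
    exact hA.isEmbedding.t2Space
  obtain ⟨φ₀, hiso, hplanes⟩ :=
    exists_isotopicForm_of_commonOpenBook GirouxContactPath_holds S₁ S₂ b₁ b₂ φ ob α α' hα hα' hor
  obtain ⟨hiso', hψ⟩ := isotopicGluingMap_of_isotopicForm S₁ S₂ b₁ b₂ φ φ₀ hiso hplanes
  exact ⟨W₁, t₁, c₁, m₁, k₁, W₂, t₂, c₂, m₂, k₂, S₁, S₂, b₁, b₂, φ, φ₀.trans φ, hglue, hiso', hψ⟩

/-! ## The item -/

/-- **`SteinBisectionExists` from the open-book rendering of Baykur's Thm. 5.1, unconditionally in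
Giroux**: the statement of `steinBisectionExists_of_kahlerDecomposition_openBook` with its hypothesis
`GirouxContactPath` discharged (now a proved tree theorem, `GirouxContactPath_holds`, Etnyre 2006,
Prop. 3.18) — through the fact (`baykur_kahlerDecomposition_of_openBook`) and the landed conditional
closure `steinBisectionExists_of_baykur`. [cite: Baykur2006, Thm. 5.1] -/
theorem steinBisectionExists_of_kahlerDecomposition_openBook'
    (hK : ∀ (X : Type) [TopologicalSpace X] [T2Space X] [SecondCountableTopology X] [CompactSpace X]
        [ConnectedSpace X] [ChartedSpace (EuclideanSpace ℝ (Fin 4)) X] [IsManifold (𝓡 4) ∞ X],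
        IsOrientable (𝓡 4) X →
        ∃ (W₁ : Type) (_ : TopologicalSpace W₁) (_ : ChartedSpace (EuclideanHalfSpace 4) W₁)
          (_ : IsManifold (𝓡∂ 4) ∞ W₁) (_ : CompactSpace W₁)
          (W₂ : Type) (_ : TopologicalSpace W₂) (_ : ChartedSpace (EuclideanHalfSpace 4) W₂)
          (_ : IsManifold (𝓡∂ 4) ∞ W₂) (_ : CompactSpace W₂)
          (S₁ : SteinStructure W₁) (S₂ : SteinStructure W₂)
          (b₁ : BoundaryData (𝓡∂ 4) W₁ (𝓡 3)) (b₂ : BoundaryData (𝓡∂ 4) W₂ (𝓡 3))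
          (φ : b₁.carrier ≃ₘ⟮𝓡 3, 𝓡 3⟯ b₂.carrier)
          (ob : OpenBook b₁.carrier) (α α' : Literature.Geometry.Kaehler.MForm (𝓡 3) b₁.carrier ℝ 1),
          IsBoundaryGluing b₁ b₂ φ (𝓡 4) X ∧
          ob.IsGirouxForm (boundaryPlaneField S₁.J b₁) α ∧
          ob.IsGirouxForm (fun y => (boundaryPlaneField S₂.J b₂ (φ y)).comap
            (mfderiv (𝓡 3) (𝓡 3) φ y).toLinearMap) α' ∧
          ∀ y u v w, 0 < wedge₁₂ (α y) (Literature.Geometry.Kaehler.mextDeriv α y) u v w ↔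
            0 < wedge₁₂ (α' y) (Literature.Geometry.Kaehler.mextDeriv α' y) u v w) :
    SteinBisectionExists :=
  steinBisectionExists_of_baykur (baykur_kahlerDecomposition_of_openBook hK)

end Summit.SmoothPoincare4.SmoothPoincare4.Theorems.SteinBisection

end
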